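import Summits.Parity.GeneralizedHardyLittlewood.Theorems.GreenTaoLevelTwoGITwoCyclicInverseTensorFamily

/-!
# Route `GreenTaoLevelTwo`, crux `GITwo` (stmt-Parity-21275), line `birth`, stub `stub_cyclicInverse`:
# tensoring existentially given nilsequences over a finite index type (GT08a arXiv Lemma 65)

Seventy-fourth helper file toward the XL stub `stub_cyclicInverse` (B. Green, T. Tao, *An inverse
theorem for the Gowers `U³(G)` norm*, arXiv:math/0503014, Thm. 68 = PEMS 51 (2008) Thm. 12.8).
Block E17 (arXiv §12): the function (eq10.111) of the proof of Thm. 68 is a product over the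
frequency set `S` (cutoffs, linear brackets) and over `S × S` (quadratic brackets) of sequences each
of which is realised on SOME member of the Heisenberg class (`…FactorRealisations`,
`…LinearMonomial`, `…QuadMonomial`).  This def-free file turns a family of such existential
realisations, indexed by any `Fintype`, into one realisation of the product (via
`exists_tensor_family` and `Fintype.equivFin`):

* `exists_tensor_of_forall_fin` — `Fin k`-indexed version;
* `exists_tensor_of_forall` — arbitrary finite index type `ι`: if every `G i : ℤ → ℂ` is realised
  (`1`-bounded, `Mᵢ`-Lipschitz) in the class, so is `n ↦ ∏ᵢ G i n`, with constant `∑ᵢ Mᵢ`.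

References: [GreenTao2008U3Inverse] arXiv:math/0503014, §12, Lemma 65.
-/

noncomputable section

namespace Summit.Parity.GeneralizedHardyLittlewood.GreenTaoLevelTwoGITwoCyclicInverse

open Literature.NumberTheory.Sieve
open Literature.NumberTheory.Sieve.GreenTaoLevelTwo

/-- **Tensoring existential realisations, `Fin k`-indexed.** [cite: GreenTao2008U3Inverse, §12, Lemma 65] -/
theorem exists_tensor_of_forall_fin (H : Nilmanifold 2) {k : ℕ} (G : Fin k → ℤ → ℂ)
    (M : Fin k → ℝ) (hM : ∀ i, 0 ≤ M i)
    (h : ∀ i, ∃ Z : Nilmanifold 2, InHeisClass H Z ∧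
      ∃ (Ψ : Z.G ⧸ Z.Γ → ℂ) (g : Z.G) (p : Z.G ⧸ Z.Γ),
        (∀ y, ‖Ψ y‖ ≤ 1) ∧ (∀ y z, ‖Ψ y - Ψ z‖ ≤ M i * Z.dist y z) ∧
        ∀ n : ℤ, Ψ (g ^ n • p) = G i n) :
    ∃ Z : Nilmanifold 2, InHeisClass H Z ∧
      ∃ (Ψ : Z.G ⧸ Z.Γ → ℂ) (g : Z.G) (p : Z.G ⧸ Z.Γ),
        (∀ y, ‖Ψ y‖ ≤ 1) ∧ (∀ y z, ‖Ψ y - Ψ z‖ ≤ (∑ i, M i) * Z.dist y z) ∧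
        ∀ n : ℤ, Ψ (g ^ n • p) = ∏ i, G i n := by
  choose Z hZ Ψ g p hb hL horb using h
  obtain ⟨W, hW, Φ, gW, pW, hbW, hLW, horbW⟩ :=
    exists_tensor_family H k Z hZ Ψ g p M hM hb hL
  refine ⟨W, hW, Φ, gW, pW, hbW, hLW, fun n => ?_⟩
  rw [horbW n]
  exact Finset.prod_congr rfl fun i _ => horb i n

/-- **Tensoring existential realisations over a finite index type.**  If for every `i : ι` the
sequence `G i : ℤ → ℂ` is `Ψᵢ(gᵢⁿpᵢ)` for a `1`-bounded `Mᵢ`-Lipschitz `Ψᵢ` on a member of the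
Heisenberg class of `H`, then `n ↦ ∏ᵢ G i n` is realised the same way with constant `∑ᵢ Mᵢ`.
[cite: GreenTao2008U3Inverse, §12, Lemma 65] -/
theorem exists_tensor_of_forall (H : Nilmanifold 2) {ι : Type*} [Fintype ι] [DecidableEq ι]
    (G : ι → ℤ → ℂ) (M : ι → ℝ) (hM : ∀ i, 0 ≤ M i)
    (h : ∀ i, ∃ Z : Nilmanifold 2, InHeisClass H Z ∧
      ∃ (Ψ : Z.G ⧸ Z.Γ → ℂ) (g : Z.G) (p : Z.G ⧸ Z.Γ),
        (∀ y, ‖Ψ y‖ ≤ 1) ∧ (∀ y z, ‖Ψ y - Ψ z‖ ≤ M i * Z.dist y z) ∧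
        ∀ n : ℤ, Ψ (g ^ n • p) = G i n) :
    ∃ Z : Nilmanifold 2, InHeisClass H Z ∧
      ∃ (Ψ : Z.G ⧸ Z.Γ → ℂ) (g : Z.G) (p : Z.G ⧸ Z.Γ),
        (∀ y, ‖Ψ y‖ ≤ 1) ∧ (∀ y z, ‖Ψ y - Ψ z‖ ≤ (∑ i, M i) * Z.dist y z) ∧
        ∀ n : ℤ, Ψ (g ^ n • p) = ∏ i, G i n := by
  set e := Fintype.equivFin ι with he
  obtain ⟨Z, hZ, Ψ, g, p, hb, hL, horb⟩ := exists_tensor_of_forall_fin H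
    (fun j => G (e.symm j)) (fun j => M (e.symm j)) (fun j => hM _) (fun j => h _)
  have hsum : ∑ j : Fin (Fintype.card ι), M (e.symm j) = ∑ i, M i :=
    Fintype.sum_equiv e.symm _ _ fun j => rfl
  refine ⟨Z, hZ, Ψ, g, p, hb, fun y z => by rw [← hsum]; exact hL y z, fun n => ?_⟩
  rw [horb n]
  exact Fintype.prod_equiv e.symm _ _ fun j => rfl

end Summit.Parity.GeneralizedHardyLittlewood.GreenTaoLevelTwoGITwoCyclicInverse
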